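import Literature.Algebra.Homology.KunnethZeroDifferential
import Mathlib.Algebra.Homology.QuasiIso
import Mathlib.Algebra.Category.ModuleCat.Abelian
import Mathlib.LinearAlgebra.Basis.VectorSpace
import HarnessLib

/-!
# A complex with split cycle inclusions is quasi-isomorphic to its homology; every complex of vector spaces is

Layer `Literature/Algebra/Homology` (pure homological algebra over Mathlib; one definition, 0 named facts, no instances, no
notation). The second rung of the algebraic Künneth theorem over a field (Weibel, *An introduction to homological algebra*,
Thm. 3.6.3, whose proof begins "since every subspace of a vector space is a direct summand …"; Cartan–Eilenberg VI.3.1):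

* `toHomologyZeroDifferential C r hr : C ⟶ zeroDifferential c (fun i => C.homology i)` — given retractions
  `r i : Cⁱ → Zⁱ(C)` of the cycle inclusions (`iCycles ≫ r = 𝟙`), the chain map `Cⁱ → Zⁱ → Hⁱ(C)` to the homology of `C`
  viewed as a complex with ZERO differentials (`KunnethZeroDifferential.zeroDifferential`) — the ONLY definition;
* **`quasiIso_toHomologyZeroDifferential`** — it is a quasi-isomorphism (on homology it is the identity of `Hⁱ(C)` up to
  the canonical isomorphisms `Zⁱ = Hⁱ` of a complex with zero differentials);
* **`exists_quasiIso_zeroDifferential_homology`** — over a field `k`, EVERY complex of `k`-vector spaces admits such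
  retractions (Mathlib `LinearMap.exists_leftInverse_of_injective`), hence a quasi-isomorphism
  `C ⟶ (H•(C), d = 0)`.

## References

* C. A. Weibel, *An introduction to homological algebra* (1994), Thm. 3.6.3 and its proof. [Weibel1994]
* H. Cartan, S. Eilenberg, *Homological Algebra* (1956), VI.3, Thm. 3.1. [CartanEilenberg1956]
-/

noncomputable section

open CategoryTheory CategoryTheory.Category CategoryTheory.Limits HomologicalComplex

universe v u w

namespace Literature.Algebra.Homology

/-! ### §1 The comparison map to the homology with zero differentials -/

section General

variable {V : Type u} [Category.{v} V] [Abelian V] {I : Type w} {c : ComplexShape I}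
  (C : HomologicalComplex V c) (r : ∀ i, C.X i ⟶ C.cycles i) (hr : ∀ i, C.iCycles i ≫ r i = 𝟙 _)

/-- **The chain map `C ⟶ (H•(C), 0)`** attached to retractions `r i` of the cycle inclusions `Zⁱ(C) ↪ Cⁱ`: in degree `i`
it is `Cⁱ —r i→ Zⁱ(C) —π→ Hⁱ(C)`; it commutes with the differentials because `d = ι ∘ toCycles` and `toCycles ≫ π = 0`.
[cite: Weibel1994, Thm. 3.6.3 (proof)] -/
def toHomologyZeroDifferential : C ⟶ zeroDifferential c (fun i => C.homology i) where
  f i := r i ≫ C.homologyπ i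
  comm' i j _ := by
    change (r i ≫ C.homologyπ i) ≫ (0 : C.homology i ⟶ C.homology j) = C.d i j ≫ r j ≫ C.homologyπ j
    rw [comp_zero, ← C.toCycles_i i j, assoc, ← assoc (C.iCycles j), hr, id_comp, toCycles_comp_homologyπ]

/-- The components of `toHomologyZeroDifferential`: `Cⁱ —r i→ Zⁱ(C) —π→ Hⁱ(C)`. [cite: Weibel1994, Thm. 3.6.3 (proof)] -/
theorem toHomologyZeroDifferential_f (i : I) : (toHomologyZeroDifferential C r hr).f i = r i ≫ C.homologyπ i := rfl

/-- Restricted to the cycles, the components of `toHomologyZeroDifferential` are the homology projections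
`π : Zⁱ(C) → Hⁱ(C)`. [cite: Weibel1994, Thm. 3.6.3 (proof)] -/
theorem iCycles_comp_toHomologyZeroDifferential_f (i : I) :
    C.iCycles i ≫ (toHomologyZeroDifferential C r hr).f i = C.homologyπ i := by
  change C.iCycles i ≫ r i ≫ C.homologyπ i = C.homologyπ i
  rw [← assoc, hr, id_comp]

/-- On cycles, `toHomologyZeroDifferential` followed by the (invertible) cycle inclusion of the target is
`π : Zⁱ(C) → Hⁱ(C)`. [cite: Weibel1994, Thm. 3.6.3 (proof)] -/
theorem cyclesMap_toHomologyZeroDifferential_comp_iCycles (i : I) :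
    cyclesMap (toHomologyZeroDifferential C r hr) i ≫ (zeroDifferential c (fun i => C.homology i)).iCycles i =
      C.homologyπ i :=
  (cyclesMap_i _ i).trans (iCycles_comp_toHomologyZeroDifferential_f C r hr i)

/-- **On homology, `toHomologyZeroDifferential` is `ι⁻¹ ≫ π`** for the target complex `(H•(C), 0)`, whose cycle
inclusions `ι` and homology projections `π` are isomorphisms (its differentials vanish; Mathlib
`HomologicalComplex.iCyclesIso`, `isIso_homologyπ`). [cite: Weibel1994, Thm. 3.6.3 (proof)] -/
theorem homologyMap_toHomologyZeroDifferential (i : I) :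
    homologyMap (toHomologyZeroDifferential C r hr) i =
      ((zeroDifferential c (fun i => C.homology i)).iCyclesIso i (c.next i) rfl rfl).inv ≫
        (zeroDifferential c (fun i => C.homology i)).homologyπ i := by
  -- `Z(ρ) ≫ ι = π_C`, i.e. `π_C ≫ ι⁻¹ = Z(ρ)`
  have hA : cyclesMap (toHomologyZeroDifferential C r hr) i ≫
      ((zeroDifferential c (fun i => C.homology i)).iCyclesIso i (c.next i) rfl rfl).hom = C.homologyπ i := by
    rw [iCyclesIso_hom]
    exact cyclesMap_toHomologyZeroDifferential_comp_iCycles C r hr i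
  have hB := (Iso.comp_inv_eq ((zeroDifferential c (fun i => C.homology i)).iCyclesIso i (c.next i) rfl rfl)).mpr
    hA.symm
  -- naturality of `π`: `π_C ≫ H(ρ) = Z(ρ) ≫ π = π_C ≫ ι⁻¹ ≫ π`, and `π_C` is an epimorphism
  have hC := homologyπ_naturality (toHomologyZeroDifferential C r hr) i
  rw [← hB, assoc] at hC
  exact (cancel_epi (C.homologyπ i)).mp hC

/-- **`C ⟶ (H•(C), 0)` is a quasi-isomorphism** whenever the cycle inclusions are split (`H(ρ) = ι⁻¹ ≫ π`, a composite of
isomorphisms). [cite: Weibel1994, Thm. 3.6.3 (proof)] -/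
theorem quasiIso_toHomologyZeroDifferential : QuasiIso (toHomologyZeroDifferential C r hr) where
  quasiIsoAt i := by
    haveI := (zeroDifferential c (fun i => C.homology i)).isIso_homologyπ (c.prev i) i rfl rfl
    have hiso : IsIso (((zeroDifferential c (fun i => C.homology i)).iCyclesIso i (c.next i) rfl rfl).inv ≫
        (zeroDifferential c (fun i => C.homology i)).homologyπ i) := inferInstance
    rw [quasiIsoAt_iff_isIso_homologyMap, homologyMap_toHomologyZeroDifferential C r hr i]
    exact hiso

end General

/-! ### §2 Over a field every complex is quasi-isomorphic to its homology -/

section Field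

variable {k : Type u} [Field k] {I : Type w} {c : ComplexShape I} (C : HomologicalComplex (ModuleCat.{u} k) c)

/-- Over a field the cycle inclusions `Zⁱ(C) ↪ Cⁱ` are split monomorphisms ("every subspace of a vector space is a direct
summand"). [cite: Weibel1994, Thm. 3.6.3 (proof)] -/
theorem exists_retraction_iCycles (i : I) : ∃ r : C.X i ⟶ C.cycles i, C.iCycles i ≫ r = 𝟙 _ := by
  have hinj : Function.Injective (C.iCycles i) := (ModuleCat.mono_iff_injective _).mp inferInstance
  obtain ⟨g, hg⟩ := (C.iCycles i).hom.exists_leftInverse_of_injective (LinearMap.ker_eq_bot.mpr hinj)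
  exact ⟨ModuleCat.ofHom g, by ext x; exact LinearMap.congr_fun hg x⟩

/-- **Every complex of vector spaces is quasi-isomorphic to its homology with zero differentials**: there is a
quasi-isomorphism `C ⟶ (H•(C), d = 0)`. [cite: Weibel1994, Thm. 3.6.3] [cite: CartanEilenberg1956, VI.3 Thm. 3.1] -/
theorem exists_quasiIso_zeroDifferential_homology :
    ∃ ρ : C ⟶ zeroDifferential c (fun i => C.homology i), QuasiIso ρ :=
  ⟨toHomologyZeroDifferential C (fun i => (exists_retraction_iCycles C i).choose)
      (fun i => (exists_retraction_iCycles C i).choose_spec),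
    quasiIso_toHomologyZeroDifferential C _ _⟩

end Field

end Literature.Algebra.Homology

end
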